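import Summits.ResolutionOfSingularities.ResolutionOfSingularities.Theorems.WildConesCampaignW46FormalChart
import Literature.AlgebraicGeometry.Resolution.AdicQuotient
import HarnessLib

/-!
# [OURS · L1 W4.6, rungs (i)/(ii) — the dictionary, SCHEME HALF, brick 5a] Formal-chart recognition with the
# dimension hypothesis as an inequality; local rings under ring isomorphisms; the map of completions on constants

Cell res-hironaka (LADDER-RESOLUTION rung L, D-0089), slot W4.6, seat res-L1-s46-pv-2 (gen 2). Host: route
`WildCones`, crux `ClassicalRegimes` (stmt-ResolutionOfSingularities-16884), `--supports … --as helper`.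

HONEST FRAMING. Everything here is OURS and is ordinary commutative algebra; NOTHING here is a statement of
H. Hironaka's manuscript [Hironaka2017] and nothing of it is used; no FACT-LIST premise. AI review is weaker than
expert review.

Small complements to brick 1 (`Theorems/WildConesCampaignW46FormalChart.lean`) used by the assembly brick 5
(`…FormalChartAssembly.lean`): `ringKrullDim_eq_of_le` (a complete local ring receiving a chart has dimension
`≤ |σ|` by complete Nakayama, so `|σ| ≤ dim C` suffices), `exists_ringEquiv_chart_of_le`,
`exists_ringEquiv_chart_shear_of_le`; `ringEquiv_mem_maximalIdeal(_pow)` (ring isomorphisms of local rings respect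
the maximal ideals and their powers); `adicCompletionMap_algebraMap` (the tree's map of adic completions
`adicCompletionMap`, `AdicQuotient.lean`, extends the given map).

References: H. Matsumura, *Commutative Ring Theory* (1986), Thm. 8.4, 29.7. [Matsumura1987] [folklore]
-/

noncomputable section

-- single-problem summit: the doubled namespace component `ResolutionOfSingularities` is forced
set_option linter.dupNamespace false

open IsLocalRing MvPowerSeries

namespace Summit.ResolutionOfSingularities.ResolutionOfSingularities.Theorems

namespace CampaignW46.FormalChart

open Literature.AlgebraicGeometry.Resolution

universe u

/-! ## Recognition with the dimension hypothesis as an inequality -/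

section OfLe

variable {κ : Type u} [Field κ] {C : Type u} [CommRing C] [IsLocalRing C] [IsNoetherianRing C]
  [IsAdicComplete (maximalIdeal C) C] {σ : Type} [Fintype σ] [DecidableEq σ]

/-- The dimension of a complete local ring receiving a chart as in `exists_ringEquiv_chart` is AT MOST `|σ|` (it is
a quotient of `κ⟦X_σ⟧` by complete Nakayama), so the hypothesis `dim C = |σ|` may be replaced by `|σ| ≤ dim C`.
[cite: Matsumura1987, Thm. 8.4] [folklore] -/
theorem ringKrullDim_eq_of_le (φ : MvPowerSeries σ κ →+* C)
    (hres : ∀ x : C, ∃ l : κ, x - φ (MvPowerSeries.C l) ∈ maximalIdeal C)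
    (i : σ) (e : σ → C) (τ : σ → κ)
    (hgen : Ideal.span (Set.range fun j : σ =>
        if j = i then φ (X i) else e j - φ (MvPowerSeries.C (τ j))) = maximalIdeal C)
    (hdim : (Fintype.card σ : WithBot ℕ∞) ≤ ringKrullDim C) : ringKrullDim C = Fintype.card σ := by
  obtain ⟨Ψ, -, -, hsurj⟩ := exists_mvPowerSeries_ringHom_surjective (φ.comp MvPowerSeries.C)
    (fun x => hres x) _ hgen
  refine le_antisymm ?_ hdim
  have h := ringKrullDim_le_of_surjective Ψ hsurj
  rwa [ringKrullDim_mvPowerSeries κ σ, Nat.card_eq_fintype_card] at h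

/-- `exists_ringEquiv_chart` with `|σ| ≤ dim C`. [cite: Matsumura1987, Thm. 29.7] [folklore] -/
theorem exists_ringEquiv_chart_of_le (φ : MvPowerSeries σ κ →+* C)
    (hres : ∀ x : C, ∃ l : κ, x - φ (MvPowerSeries.C l) ∈ maximalIdeal C)
    (i : σ) (e : σ → C) (he : ∀ j, j ≠ i → φ (X j) = φ (X i) * e j) (τ : σ → κ)
    (hgen : Ideal.span (Set.range fun j : σ =>
        if j = i then φ (X i) else e j - φ (MvPowerSeries.C (τ j))) = maximalIdeal C)
    (hdim : (Fintype.card σ : WithBot ℕ∞) ≤ ringKrullDim C) :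
    ∃ E : C ≃+* MvPowerSeries σ κ,
      (∀ l, E (φ (MvPowerSeries.C l)) = MvPowerSeries.C l) ∧ E (φ (X i)) = X i ∧
      (∀ j, j ≠ i → E (e j) = X j + MvPowerSeries.C (τ j)) ∧
      (∀ j, j ≠ i → E (φ (X j)) = X i * (X j + MvPowerSeries.C (τ j))) :=
  exists_ringEquiv_chart φ hres i e he τ hgen (ringKrullDim_eq_of_le φ hres i e τ hgen hdim)

/-- `exists_ringEquiv_chart_shear` with `|σ| ≤ dim C`. [cite: Matsumura1987, Thm. 29.7] [folklore] -/
theorem exists_ringEquiv_chart_shear_of_le (φ : MvPowerSeries σ κ →+* C)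
    (hres : ∀ x : C, ∃ l : κ, x - φ (MvPowerSeries.C l) ∈ maximalIdeal C)
    (i : σ) (e : σ → C) (he : ∀ j, j ≠ i → φ (X j) = φ (X i) * e j) (τ : σ → κ)
    (hgen : Ideal.span (Set.range fun j : σ =>
        if j = i then φ (X i) else e j - φ (MvPowerSeries.C (τ j))) = maximalIdeal C)
    (hdim : (Fintype.card σ : WithBot ℕ∞) ≤ ringKrullDim C) (z : σ) (hz : z ≠ i) (s : MvPowerSeries σ κ)
    (hs0 : constantCoeff s = 0)
    (hs : subst (fun j : σ => if j = z then (0 : MvPowerSeries σ κ) else X j) s = s) :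
    ∃ E : C ≃+* MvPowerSeries σ κ,
      (∀ l, E (φ (MvPowerSeries.C l)) = MvPowerSeries.C l) ∧ E (φ (X i)) = X i ∧
      (∀ j, j ≠ i → j ≠ z → E (φ (X j)) = X i * (X j + MvPowerSeries.C (τ j))) ∧
      E (φ (X z)) = X i * (X z + MvPowerSeries.C (τ z) + s) :=
  exists_ringEquiv_chart_shear φ hres i e he τ hgen (ringKrullDim_eq_of_le φ hres i e τ hgen hdim) z hz s hs0 hs

end OfLe

/-! ## Local rings and ring isomorphisms -/

/-- A ring isomorphism of local rings maps the maximal ideal into the maximal ideal. [folklore] -/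
theorem ringEquiv_mem_maximalIdeal {A B : Type*} [CommRing A] [CommRing B] [IsLocalRing A] [IsLocalRing B]
    (e : A ≃+* B) {x : A} (hx : x ∈ maximalIdeal A) : e x ∈ maximalIdeal B := by
  rw [IsLocalRing.mem_maximalIdeal, mem_nonunits_iff] at hx ⊢
  rwa [MulEquiv.isUnit_map]

/-- A ring isomorphism of local rings maps powers of the maximal ideal into powers of the maximal ideal. [folklore] -/
theorem ringEquiv_mem_maximalIdeal_pow {A B : Type*} [CommRing A] [CommRing B] [IsLocalRing A] [IsLocalRing B]
    (e : A ≃+* B) {k : ℕ} {x : A} (hx : x ∈ maximalIdeal A ^ k) : e x ∈ maximalIdeal B ^ k := by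
  have hle : (maximalIdeal A ^ k).map e.toRingHom ≤ maximalIdeal B ^ k := by
    rw [Ideal.map_pow]
    refine Ideal.pow_right_mono ?_ k
    rw [Ideal.map_le_iff_le_comap]
    intro y hy
    exact ringEquiv_mem_maximalIdeal e hy
  exact hle (Ideal.mem_map_of_mem _ hx)

/-! ## The map of completions on constants -/

/-- The map of completions extends `g`. [folklore] -/
theorem adicCompletionMap_algebraMap {R L : Type u} [CommRing R] [CommRing L] [IsLocalRing R] [IsLocalRing L]
    (g : R →+* L) (hg : (maximalIdeal R).map g ≤ maximalIdeal L) (r : R) :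
    adicCompletionMap (maximalIdeal R) (maximalIdeal L) g hg (algebraMap R (AdicCompletion (maximalIdeal R) R) r) =
      algebraMap L (AdicCompletion (maximalIdeal L) L) (g r) := by
  rw [AdicCompletion.algebraMap_apply, AdicCompletion.algebraMap_apply, Algebra.algebraMap_self_apply,
    Algebra.algebraMap_self_apply]
  exact adicCompletionMap_of _ _ g hg r

end CampaignW46.FormalChart

end Summit.ResolutionOfSingularities.ResolutionOfSingularities.Theorems

end
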